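import Literature.AlgebraicGeometry.Resolution.MacaulayficationKawasakiStepsOne
import HarnessLib

/-!
# Kawasaki's interwoven induction, Step 3 (Kawasaki 2000, proof of Thm. 3.1)

Topic: `Literature/AlgebraicGeometry/Resolution`. Brick of the proof of the named facts
`KawasakiMacaulayfication` / `CesnaviciusMacaulayfication`; sequel of
`MacaulayficationKawasakiStepsOne.lean`. Step 3 of the printed proof of Kawasaki 2000, Thm. 3.1
(p. 2524): **`(B_ii)` implies `(C_ii)` and `(E_ii)`.** "By using `(B_ii)`, we have
`[(Y)M + qᵢ^{nᵢ}M] : y_u = qᵢ^{nᵢ-1}{[(Y)M + qᵢM] : y_u} + (Y)M : y_u` [iterating the case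
`l = d` of `(B_ii)`, `Kawasaki.b31_iterate`] … Furthermore, if `y_u ∈ 𝔞(M/q_kM)`, then (2.9.2)
says that `(y₁,…,y_{v-1})M : y_vy_u = (y₁,…,y_{v-1})M : y_u`. Thus we may assume that `nᵢ = 1`.
Then `(C_ii)` is trivial and `(E_ii)` is included in Theorem 2.9."

* `Kawasaki.b31_iterate` — the iteration `[(Y)M + qᵢ^{t+1}M] : y = qᵢ^{t}{[(Y)M + qᵢM] : y} + (Y)M : y`;
* `Kawasaki.c31_self_of_b31` — `(B_ii) ⇒ (C_ii)`;
* `IsPStandard.kawasakiE31_self_of_b31` — `(B_ii) ⇒ (E_ii)` (with Theorem 2.9).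

Everything is proved; no named fact is introduced.

## References

* [Kawasaki2000] T. Kawasaki, *On Macaulayfication of Noetherian schemes*, Trans. AMS 352 (2000)
  2517–2552, proof of Thm. 3.1, Step 3; Thm. 2.9.
-/

namespace Literature.AlgebraicGeometry.Resolution

open Ideal Submodule Module IsLocalRing
open scoped Pointwise

universe u v

variable {R : Type u} [CommRing R] [IsLocalRing R]
variable {M : Type v} [AddCommGroup M] [Module R M]

namespace Kawasaki

/-- **Iterating `(B_ii)` at `l = d`**: if `(B_ii)` holds, `i < d`, and `Y, y` is a subsystem of
parameters of `M/q_{i+1}M`, then for every `t`,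
`[(Y)M + qᵢ₊₁^{t+1}M] : y = qᵢ₊₁^{t}·{[(Y)M + qᵢ₊₁M] : y} + (Y)M : y`
("By using `(B_ii)`, we have …", Step 3; induction on `t`, using `q·((Y)M : y) ⊆ (Y)M : y`).
[cite: Kawasaki2000, Thm. 3.1, Step 3] -/
theorem b31_iterate {xs : List R} {i : ℕ} (hB : B31 M xs i i) (hi : i < xs.length)
    {Y : List R} {y : R} (hys : IsSecantSequence M (xs.drop i ++ (Y ++ [y])))
    (hym : ∀ z ∈ Y ++ [y], z ∈ maximalIdeal R) (t : ℕ) :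
    colonBy (ofList Y • ⊤ ⊔ tailIdeal xs i ^ (t + 1) • ⊤ : Submodule R M) y =
      tailIdeal xs i ^ t • colonBy (ofList Y • ⊤ ⊔ tailIdeal xs i • ⊤ : Submodule R M) y ⊔
        colonBy (ofList Y • ⊤ : Submodule R M) y := by
  induction t with
  | zero =>
    rw [zero_add, pow_one, pow_zero, one_eq_top, Submodule.top_smul, eq_comm, sup_eq_left]
    exact colonBy_mono le_sup_left _
  | succ t ih =>
    -- `(B_ii)` with the constant exponent `t + 1`, `k = i`, `l = d - 1`
    obtain ⟨d', hd'⟩ : ∃ d', xs.length = d' + 1 := ⟨xs.length - 1, by omega⟩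
    have key := hB (fun _ => t + 1) (fun _ _ => Nat.succ_pos t) Y y hys hym i d' le_rfl le_rfl
      (by omega) (by omega)
    rw [← hd', seg_length, prodPow_self] at key
    change colonBy (ofList Y • ⊤ ⊔ tailIdeal xs i • (tailIdeal xs i ^ (t + 1) • ⊤)) y =
      tailIdeal xs i • colonBy (ofList Y • ⊤ ⊔ tailIdeal xs i ^ (t + 1) • ⊤) y ⊔
        colonBy (ofList Y • ⊤) y at key
    rw [← Submodule.mul_smul, ← pow_succ'] at key
    rw [key, ih, Submodule.smul_sup, ← Submodule.mul_smul, ← pow_succ', sup_assoc]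
    congr 1
    exact sup_eq_right.mpr Submodule.smul_le_right

/-- **Step 3 of Kawasaki 2000, Thm. 3.1, first half: `(B_ii) ⇒ (C_ii)`** ("Thus we may assume
that `nᵢ = 1`. Then `(C_ii)` is trivial"). [cite: Kawasaki2000, Thm. 3.1, Step 3] -/
theorem c31_self_of_b31 {xs : List R} {i : ℕ} (hB : B31 M xs i i) (hi : i < xs.length) :
    C31 M xs i i := by
  intro n hn Y yu hys hym
  obtain ⟨t, ht⟩ : ∃ t, n i = t + 1 := ⟨n i - 1, by have := hn i (by simp); omega⟩
  rw [prodPow_self, prodPow_self, Function.update_self, ht, Nat.add_sub_cancel,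
    b31_iterate hB hi hys hym t, sup_comm]
  exact sup_le_sup_left (Submodule.smul_mono le_rfl le_top) _

end Kawasaki

section StepThree

variable [IsNoetherianRing R] [Module.Finite R M]

/-- **Step 3 of Kawasaki 2000, Thm. 3.1, second half: `(B_ii) ⇒ (E_ii)`** for a `p`-standard
`xs`: after `Kawasaki.b31_iterate` (applied to the subsystems of parameters
`y₁,…,y_{v-1}, x_Λ, y_vy_u` and `y₁,…,y_{v-1}, x_Λ, y_u` of `M/qᵢ₊₁M`), both colon modules of
`(E_ii)` are `qᵢ₊₁^{nᵢ-1}·{[(y_{<v},x_Λ)M + qᵢ₊₁M] : *} + (y_{<v},x_Λ)M : *` with `* = y_vy_u`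
resp. `y_u`, and these agree by Theorem 2.9, (2.9.1) for `Λ` and for `Λ ∪ {i+1,…,d}` ("Then
`(E_ii)` is included in Theorem 2.9"). [cite: Kawasaki2000, Thm. 3.1, Step 3] -/
theorem IsPStandard.kawasakiE31_self_of_b31 {xs : List R} (hx : IsPStandard M xs) {i : ℕ}
    (hB : Kawasaki.B31 M xs i i) (hi : i < xs.length) : Kawasaki.E31 M xs i i := by
  classical
  intro n hn k hki ys Y yu hY hys hym hkill m hm L hL
  obtain ⟨t, ht⟩ : ∃ t, n i = t + 1 := ⟨n i - 1, by have := hn i (by simp); omega⟩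
  have hS : ∀ r ∈ xs.drop k ++ ys, r ∈ maximalIdeal R := fun r hr => by
    rcases List.mem_append.mp hr with hr | hr
    · exact hx.mem_maximalIdeal r (List.mem_of_mem_drop hr)
    · exact hym r hr
  have hdk : xs.drop k = seg xs k i ++ xs.drop i := (seg_append_drop hki).symm
  have hmY : m ≤ Y.length := by
    rw [hY, List.length_append, List.length_singleton] at hm; omega
  have hTv : (ys.take m ++ [ys[m]]).Sublist ys := by
    rw [← List.take_succ_eq_append_getElem hm]
    exact List.take_sublist _ _
  have hTu : (ys.take m ++ [yu]).Sublist ys := by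
    conv_rhs => rw [hY]
    rw [hY, List.take_append_of_le_length hmY]
    exact (List.take_sublist m Y).append (List.Sublist.refl [yu])
  -- the two enlarged subsystems of parameters of `M/qᵢ₊₁M`
  have hWv : IsSecantSequence M (xs.drop i ++ ((ys.take m ++ L) ++ [ys[m]])) := by
    refine hys.of_subperm ⟨L ++ xs.drop i ++ (ys.take m ++ [ys[m]]),
      List.perm_iff_count.mpr fun r => by simp only [List.count_append]; omega, ?_⟩ hS
    rw [hdk]
    exact (hL.append (List.Sublist.refl _)).append hTv
  have hWu : IsSecantSequence M (xs.drop i ++ ((ys.take m ++ L) ++ [yu])) := by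
    refine hys.of_subperm ⟨L ++ xs.drop i ++ (ys.take m ++ [yu]),
      List.perm_iff_count.mpr fun r => by simp only [List.count_append]; omega, ?_⟩ hS
    rw [hdk]
    exact (hL.append (List.Sublist.refl _)).append hTu
  have hWvu : IsSecantSequence M (xs.drop i ++ ((ys.take m ++ L) ++ [ys[m] * yu])) := by
    rw [← List.append_assoc] at hWv hWu ⊢
    exact hWv.append_mul hWu
  have hWm : ∀ z ∈ ys.take m ++ L, z ∈ maximalIdeal R := fun z hz => by
    rcases List.mem_append.mp hz with hz | hz
    · exact hym z (List.mem_of_mem_take hz)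
    · exact hx.mem_maximalIdeal z (List.mem_of_mem_drop ((seg_sublist_drop xs k i).subset (hL.subset hz)))
  have hyum : yu ∈ maximalIdeal R := hym yu (by rw [hY]; simp)
  have hWvum : ∀ z ∈ (ys.take m ++ L) ++ [ys[m] * yu], z ∈ maximalIdeal R := fun z hz => by
    rcases List.mem_append.mp hz with hz | hz
    · exact hWm z hz
    · rw [List.mem_singleton] at hz
      rw [hz]
      exact Ideal.mul_mem_left _ _ hyum
  have hWum : ∀ z ∈ (ys.take m ++ L) ++ [yu], z ∈ maximalIdeal R := fun z hz => by
    rcases List.mem_append.mp hz with hz | hz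
    · exact hWm z hz
    · rw [List.mem_singleton] at hz
      rw [hz]
      exact hyum
  -- Theorem 2.9 for `Λ` and for `Λ ∪ {i+1,…,d}`
  have hkill' : KillsParameterColons M yu ∨
      KillsParameterColons (M ⧸ (ofList (xs.drop k) • ⊤ : Submodule R M)) yu := Or.inr hkill
  have hL1 : L.Sublist (xs.drop k) := hL.trans (seg_sublist_drop xs k i)
  have hL2 : (L ++ xs.drop i).Sublist (xs.drop k) := by
    rw [hdk]; exact hL.append (List.Sublist.refl _)
  have e29a := hx.colonBy_mul_eq_colonBy (X₀ := xs.take k) (D := xs.drop k)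
    (List.take_append_drop k xs).symm hys hym hY hkill' hL1 hm
  have e29b := hx.colonBy_mul_eq_colonBy (X₀ := xs.take k) (D := xs.drop k)
    (List.take_append_drop k xs).symm hys hym hY hkill' hL2 hm
  rw [← List.append_assoc, ofList_append_smul] at e29b
  -- assemble
  rw [prodPow_self, ht, Kawasaki.b31_iterate hB hi hWvu hWvum t, Kawasaki.b31_iterate hB hi hWu hWum t,
    e29a, e29b]

end StepThree

end Literature.AlgebraicGeometry.Resolution
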